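import Summits.AtomisticToContinuum.Crystallization.Theorems.FrustratedLawDichotomyStrainedPatchHomWrecCurvature
import Summits.AtomisticToContinuum.Crystallization.Theorems.FrustratedLawDichotomyStrainedPatchTaylorLeaves

/-!
# The curvature coefficients `β = W₄₅′/ρ`, `α = (W₄₅″ − W₄₅′/ρ)/ρ²` of the record potential as explicit functions of `q = ρ²`, per regime

decomp-a2c hand-1 g26 (crux `AperiodicFrustratedLawGap`, stmt-AtomisticToContinuum-27623; `(H) HomFloor (1/625)`, hcp half; `λ`-leaf of lever (C),
critic rows 1026 (C) / 1030).  REAL-SIDE LINK between the tree's closed forms (`…HomTermCalculus.deriv_effPot45_*`, `…HomWrecCurvature.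
hasDerivAt_deriv_effPot45_*`) and the expressions the kernel encloses (`…HomCurvCoeff`: `phiFI`, `alphaLJFI`, `betaBumpFI`, `alphaBumpFI`, and the
window forms below), all written in `q = ρ²`, `q⁻¹`, `ρ` only (`1/ρ = ρ·q⁻¹`):

* §1 Lennard-Jones `8/5 < ρ < 3`: `β = q⁻⁴ − q⁻⁷`, `α = 14q⁻⁸ − 8q⁻⁵`;
* §2 bump `0 < ρ < 8/5`: `β = (q⁻⁴ − q⁻⁷) − (3/160)(5/4)S(5ρ/4)`, `α = (14q⁻⁸ − 8q⁻⁵) − (3/160)((5/4)P″(w) − (5/4)S(w))q⁻¹`;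
* §3 window `3 < ρ < 9/2`: `β = (q⁻⁴ − q⁻⁷)c + V·c′·ρ·q⁻¹`, `α = (14q⁻⁸ − 8q⁻⁵)c + (2ρ(q⁻⁴ − q⁻⁷)c′ − V c′ ρ q⁻¹ + V c″)q⁻¹`, `V = q⁻⁶/12 − q⁻³/6`;
* §4 far `9/2 < ρ`: `β = α = 0`;  §5 `regime_cases`: a radius `> 0` off the junctions `{8/5, 3, 9/2}` lies in exactly one open regime.

NO definitions; 0 sorry; standard axioms; no instances / notation / `#eval`.  `--supports stmt-AtomisticToContinuum-27623`.
-/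

noncomputable section

namespace Summit.AtomisticToContinuum.Crystallization.Theorems.FrustratedLawDichotomyStrainedPatchHomCurvRegime

open Literature.MathematicalPhysics.StatisticalMechanics (lennardJones)
open Summit.AtomisticToContinuum.Crystallization.Theorems.FrustratedLawDichotomySchurCut (effPot w₄₅ ω₄)
open Summit.AtomisticToContinuum.Crystallization.Theorems.FrustratedLawDichotomyStrainedPatchHomTermCalculus
  (deriv_effPot45_bump deriv_effPot45_lj deriv_effPot45_window deriv_effPot45_far)
open Summit.AtomisticToContinuum.Crystallization.Theorems.FrustratedLawDichotomyStrainedPatchHomWrecCurvature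
  (hasDerivAt_deriv_effPot45_bump hasDerivAt_deriv_effPot45_lj hasDerivAt_deriv_effPot45_window hasDerivAt_deriv_effPot45_far)
open Summit.AtomisticToContinuum.Crystallization.Theorems.FrustratedLawDichotomyStrainedPatchTaylorLeaves (junctions)

/-! ## §1. Lennard-Jones regime -/

/-- ★ `β = W′/ρ = q⁻⁴ − q⁻⁷` on `8/5 < ρ < 3` (`q = ρ²`). [arithmetic] -/
theorem beta_lj {ρ : ℝ} (h1 : 8 / 5 < ρ) (h2 : ρ < 3) :
    deriv (effPot w₄₅ ω₄ (3 / 400)) ρ / ρ = ((ρ ^ 2)⁻¹) ^ 4 - ((ρ ^ 2)⁻¹) ^ 7 := by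
  have hρ : ρ ≠ 0 := by linarith
  rw [deriv_effPot45_lj h1.le h2.le]
  field_simp
  ring

/-- ★ `α = (W″ − W′/ρ)/ρ² = 14q⁻⁸ − 8q⁻⁵` on `8/5 < ρ < 3`. [arithmetic] -/
theorem alpha_lj {ρ : ℝ} (h1 : 8 / 5 < ρ) (h2 : ρ < 3) :
    (deriv (deriv (effPot w₄₅ ω₄ (3 / 400))) ρ - deriv (effPot w₄₅ ω₄ (3 / 400)) ρ / ρ) / ρ ^ 2 =
      14 * ((ρ ^ 2)⁻¹) ^ 8 - 8 * ((ρ ^ 2)⁻¹) ^ 5 := by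
  have hρ : ρ ≠ 0 := by linarith
  rw [(hasDerivAt_deriv_effPot45_lj h1 h2).deriv, deriv_effPot45_lj h1.le h2.le]
  field_simp
  ring

/-! ## §2. Bump regime -/

/-- ★ `β` on `0 < ρ < 8/5`. [arithmetic] -/
theorem beta_bump {ρ : ℝ} (h0 : 0 < ρ) (h1 : ρ < 8 / 5) :
    deriv (effPot w₄₅ ω₄ (3 / 400)) ρ / ρ = ((ρ ^ 2)⁻¹) ^ 4 - ((ρ ^ 2)⁻¹) ^ 7 -
      3 / 160 * (5 / 4 * (-(11 / 3) + 33 / 4 * (5 * ρ / 4) ^ 2 - 385 / 64 * (5 * ρ / 4) ^ 3 + 231 / 256 * (5 * ρ / 4) ^ 5 -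
        99 / 1024 * (5 * ρ / 4) ^ 7 + 55 / 12288 * (5 * ρ / 4) ^ 9)) := by
  have hρ : ρ ≠ 0 := h0.ne'
  rw [deriv_effPot45_bump h0 h1.le]
  field_simp
  ring

/-- ★ `α` on `0 < ρ < 8/5`. [arithmetic] -/
theorem alpha_bump {ρ : ℝ} (h0 : 0 < ρ) (h1 : ρ < 8 / 5) :
    (deriv (deriv (effPot w₄₅ ω₄ (3 / 400))) ρ - deriv (effPot w₄₅ ω₄ (3 / 400)) ρ / ρ) / ρ ^ 2 =
      14 * ((ρ ^ 2)⁻¹) ^ 8 - 8 * ((ρ ^ 2)⁻¹) ^ 5 -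
      3 / 160 * ((5 / 4 * (-(11 / 3) + 99 / 4 * (5 * ρ / 4) ^ 2 - 385 / 16 * (5 * ρ / 4) ^ 3 + 693 / 128 * (5 * ρ / 4) ^ 5 -
          99 / 128 * (5 * ρ / 4) ^ 7 + 275 / 6144 * (5 * ρ / 4) ^ 9) -
        5 / 4 * (-(11 / 3) + 33 / 4 * (5 * ρ / 4) ^ 2 - 385 / 64 * (5 * ρ / 4) ^ 3 + 231 / 256 * (5 * ρ / 4) ^ 5 -
          99 / 1024 * (5 * ρ / 4) ^ 7 + 55 / 12288 * (5 * ρ / 4) ^ 9)) * (ρ ^ 2)⁻¹) := by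
  have hρ : ρ ≠ 0 := h0.ne'
  rw [(hasDerivAt_deriv_effPot45_bump h0 h1).deriv, deriv_effPot45_bump h0 h1.le]
  field_simp
  ring

/-! ## §3. Window regime -/

/-- ★ `β` on `3 < ρ < 9/2`: `(q⁻⁴ − q⁻⁷)·c(ρ) + V(q)·c′(ρ)·ρ·q⁻¹`. [arithmetic] -/
theorem beta_window {ρ : ℝ} (h1 : 3 < ρ) (h2 : ρ < 9 / 2) :
    deriv (effPot w₄₅ ω₄ (3 / 400)) ρ / ρ =
      (((ρ ^ 2)⁻¹) ^ 4 - ((ρ ^ 2)⁻¹) ^ 7) * ((16 * ρ ^ 3 - 180 * ρ ^ 2 + 648 * ρ - 729) / 27) +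
        (1 / 12 * ((ρ ^ 2)⁻¹) ^ 6 - 1 / 6 * ((ρ ^ 2)⁻¹) ^ 3) * ((16 * ρ ^ 2 - 120 * ρ + 216) / 9) * ρ * (ρ ^ 2)⁻¹ := by
  have hρ : ρ ≠ 0 := by linarith
  rw [deriv_effPot45_window h1.le h2.le]
  simp only [lennardJones]
  field_simp
  ring

/-- ★ `α` on `3 < ρ < 9/2`. [arithmetic] -/
theorem alpha_window {ρ : ℝ} (h1 : 3 < ρ) (h2 : ρ < 9 / 2) :
    (deriv (deriv (effPot w₄₅ ω₄ (3 / 400))) ρ - deriv (effPot w₄₅ ω₄ (3 / 400)) ρ / ρ) / ρ ^ 2 =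
      (14 * ((ρ ^ 2)⁻¹) ^ 8 - 8 * ((ρ ^ 2)⁻¹) ^ 5) * ((16 * ρ ^ 3 - 180 * ρ ^ 2 + 648 * ρ - 729) / 27) +
        (2 * ρ * (((ρ ^ 2)⁻¹) ^ 4 - ((ρ ^ 2)⁻¹) ^ 7) * ((16 * ρ ^ 2 - 120 * ρ + 216) / 9) -
          (1 / 12 * ((ρ ^ 2)⁻¹) ^ 6 - 1 / 6 * ((ρ ^ 2)⁻¹) ^ 3) * ((16 * ρ ^ 2 - 120 * ρ + 216) / 9) * ρ * (ρ ^ 2)⁻¹ +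
          (1 / 12 * ((ρ ^ 2)⁻¹) ^ 6 - 1 / 6 * ((ρ ^ 2)⁻¹) ^ 3) * ((32 * ρ - 120) / 9)) * (ρ ^ 2)⁻¹ := by
  have hρ : ρ ≠ 0 := by linarith
  rw [(hasDerivAt_deriv_effPot45_window h1 h2).deriv, deriv_effPot45_window h1.le h2.le]
  simp only [lennardJones]
  field_simp
  ring

/-! ## §4. Far regime -/

/-- ★ `β = 0` on `9/2 < ρ`. [arithmetic] -/
theorem beta_far {ρ : ℝ} (h : 9 / 2 < ρ) : deriv (effPot w₄₅ ω₄ (3 / 400)) ρ / ρ = 0 := by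
  rw [deriv_effPot45_far h.le, zero_div]

/-- ★ `α = 0` on `9/2 < ρ`. [arithmetic] -/
theorem alpha_far {ρ : ℝ} (h : 9 / 2 < ρ) :
    (deriv (deriv (effPot w₄₅ ω₄ (3 / 400))) ρ - deriv (effPot w₄₅ ω₄ (3 / 400)) ρ / ρ) / ρ ^ 2 = 0 := by
  rw [(hasDerivAt_deriv_effPot45_far h).deriv, deriv_effPot45_far h.le]; simp

/-! ## §5. Regime dispatch off the junctions -/

/-- ★ A radius `ρ > 0` off the junction radii lies in exactly one of the four OPEN regimes. [formal bookkeeping] -/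
theorem regime_cases {ρ : ℝ} (h0 : 0 < ρ) (hJ : ρ ∉ junctions) :
    (0 < ρ ∧ ρ < 8 / 5) ∨ (8 / 5 < ρ ∧ ρ < 3) ∨ (3 < ρ ∧ ρ < 9 / 2) ∨ 9 / 2 < ρ := by
  have h1 : ρ ≠ 8 / 5 ∧ ρ ≠ 3 ∧ ρ ≠ 9 / 2 := by simpa [junctions] using hJ
  rcases lt_or_gt_of_ne h1.1 with ha | ha
  · exact Or.inl ⟨h0, ha⟩
  rcases lt_or_gt_of_ne h1.2.1 with hb | hb
  · exact Or.inr (Or.inl ⟨ha, hb⟩)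
  rcases lt_or_gt_of_ne h1.2.2 with hc | hc
  · exact Or.inr (Or.inr (Or.inl ⟨hb, hc⟩))
  · exact Or.inr (Or.inr (Or.inr hc))

end Summit.AtomisticToContinuum.Crystallization.Theorems.FrustratedLawDichotomyStrainedPatchHomCurvRegime

end
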